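import Literature.AlgebraicGeometry.Resolution.NeronPopescuSingularIdeal
import Mathlib.FieldTheory.SeparablyGenerated
import Mathlib.RingTheory.FinitePresentation
import HarnessLib

/-!
# Popescu's theorem from the steps of Stacks 07GC (reduction to a field, resolution lemmas)

Topic: `Literature/AlgebraicGeometry/Resolution`. Second file of the DECOMPOSITION of the named
fact `Popescu1986_generalNeronDesingularization` (Popescu 1986, Thm. (2.5) (i) ⇒ (ii); Stacks,
Tag 07GC) along the printed proof of Stacks, Theorem 07GC, which reads in full:

> By Lemma 07F5 it suffices to prove this for `k → Λ` where `Λ` is Noetherian and geometrically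
> regular over `k`. Let `k → A → Λ` be a factorization with `A` a finite type `k`-algebra. It
> suffices to construct a factorization `A → B → Λ` with `B` of finite type such that `𝔥_B = Λ`,
> see Lemma 07EU. Hence we may perform Noetherian induction on the ideal `𝔥_A`. Pick a prime
> `𝔮 ⊃ 𝔥_A` such that `𝔮` is minimal over `𝔥_A`. It now suffices to resolve
> `k → A → Λ ⊃ 𝔮`. If the characteristic of `k` is zero, this follows from Lemma 07FE. If the
> characteristic of `k` is `p > 0`, this follows from Lemma 07FJ.

Accordingly this file

* VENDORS AS NAMED FACTS two of the three deep inputs of that proof, each a theory of its own: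
  `Stacks07F5_reduceToField` (Lemma 07F5: PT for all regular maps of Noetherian rings follows
  from PT over fields; its proof uses the lifting problem 07CM, the lifting lemma 07CP, the
  desingularization lemma 07CT, 07F3, 07F4 and More on Algebra 07C1) and
  `Stacks07FE_resolveSpecial` (Lemma 07FE: resolution at a minimal prime of `𝔥_A` with regular
  local ring and separable residue field; uses Ogoma's lemma 07FC, 07FD, 07F8, 07FA, 07CE, 07EZ,
  Algebra 07BV and 07CM);
* does NOT vendor the third, **Lemma 07FJ** (the positive characteristic case: `k` of
  characteristic `p > 0`, `Λ` Noetherian and geometrically regular over `k`, `𝔮` minimal over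
  `𝔥_A` ⟹ `k → A → Λ ⊃ 𝔮` can be resolved). Its printed proof is the 26-step argument of
  Stacks 07FJ (items 07FK–07GA) resting on 07CE (improved presentations, via Elkik's lemma
  07CA), 07EZ, 07FH/07FI (solutions modulo `𝔮ⁿ`, via 07FG), Ogoma's lemma 07FC, 07F8 (hence,
  through 07F0, the lifting lemma 07CP and the desingularization lemma 07CT), 07CC, 07FA/07F9
  and Algebra 00ON, 00NQ, 07DW, 07DV, 05CK — i.e. it IS the heart of Popescu's theorem in
  characteristic `p`, not a lemma-sized input. It therefore stays part of the proof obligation of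
  `Popescu1986_generalNeronDesingularization` itself and enters the theorems below as the
  explicit hypothesis `hFJ` (D-0026 split review 2026-08-15: the former named fact
  `Stacks07FJ_resolveGeneral` was merged back; whoever discharges the parent proves 07FJ inline);
* DEFINES "`K/k` is separable" for a not necessarily algebraic field extension (Stacks, Algebra,
  Def. 030O: every finitely generated subextension is separably generated), the hypothesis (5) of
  07FE, as `IsSeparableFieldExtension k K` (with `IsSeparablyGenerated k K`, Def. 030O (1)), and
  PROVES that it holds in characteristic zero (`isSeparableFieldExtension_of_charZero`, Algebra,
  Prop. 0322 (1), from Mathlib's `exists_isTranscendenceBasis_and_isSeparable_of_perfectField`);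
* DEFINES the local problem the proof of 07GC reduces PT to, `CanResolveAtMinimalPrimes R Λ`
  ("`R → A → Λ ⊃ 𝔮` can be resolved for every `A` of finite presentation and every `𝔮` minimal
  over `𝔥_A`", the common conclusion of 07FE/07FJ quantified as 07GC uses it);
* PROVES the bridges between the tree's `IsRegularHom` / `IsGeometricallyRegular`
  (`ExcellentRings.lean`) needed to run the printed proof: a regular `k → Λ`, `k` a field, has
  `Λ` geometrically regular over `k` (`IsRegularHom.isGeometricallyRegular_of_field`), and a
  geometrically regular `Λ` is a regular ring (`IsGeometricallyRegular.isRegularRing`), so that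
  its local rings `Λ_𝔮` are regular (hypothesis (4) of 07FE);
* PROVES the reduction of PT to the local problem by the printed Noetherian induction on `𝔥_A`
  (`hasSmoothFactorizations_of_canResolveAtMinimalPrimes`, from 07EU — proved in
  `NeronPopescuSingularIdeal.lean`), the characteristic-zero case of the field case of 07GC from
  the fact 07FE alone (`canResolveAtMinimalPrimes_of_charZero`,
  `hasSmoothFactorizations_of_charZero`), the field case in every characteristic with 07FJ as
  hypothesis (`hasSmoothFactorizations_of_isGeometricallyRegular`, `hasSmoothFactorizations_field`),
  and
* PROVES the ASSEMBLY `Popescu1986_generalNeronDesingularization_of_stacks :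
  Stacks07F5_reduceToField → Stacks07FE_resolveSpecial → (Lemma 07FJ) →
  Popescu1986_generalNeronDesingularization`, together with the unfolding
  `popescu1986_iff_hasSmoothFactorizations` showing that the target fact is literally "PT holds
  for every regular homomorphism of Noetherian rings".

Discharging the two named facts (bottom-up: 07CM, 07CP, 07CT first) and proving Lemma 07FJ is
the remaining work on `Popescu1986_generalNeronDesingularization`; nothing here weakens the
target.

## Rendering notes

* 07F5 is rendered with PT in the factorisation form (`HasSmoothFactorizations`, see the
  rendering notes of `NeronPopescuSingularIdeal.lean`) and "Situation 07F2 where `R` is a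
  field" as: `k` a field, `Λ` Noetherian, `IsRegularHom k Λ`.
* 07FE/07FJ: "as in Situation 07F7" = `A` of finite presentation over the (Noetherian) field
  `k`, `φ : A →ₐ[k] Λ`, `𝔮 ⊂ Λ` prime; "`𝔮` minimal over `𝔥_A`" = `𝔮 ∈ (hIdeal k φ).minimalPrimes`;
  "`Λ_𝔮` is a regular local ring" = Mathlib's `IsRegularLocalRing (Localization.AtPrime 𝔮)`;
  "`κ(𝔮)/k` separable" = `IsSeparableFieldExtension k 𝔮.ResidueField` (Def. 030O, NOT Mathlib's
  `Algebra.IsSeparable`, which means algebraic separable); "`Λ` Noetherian and geometrically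
  regular over `k`" = `IsNoetherianRing Λ ∧ IsGeometricallyRegular k Λ` (Matsumura's definition,
  all finite `k'/k`; equivalent to Stacks 0382 for Noetherian `Λ` by Algebra, Lemma 0381);
  "field of characteristic `p > 0`" = `CharP k p` with `p` prime. The hypothesis `hFJ` of the
  assembly is Lemma 07FJ in exactly this rendering.
* Universes: one universe `u` for all rings, as in the target fact.

## Sources

* The Stacks Project, *Smoothing Ring Maps* (Tag 07BW): Lemma 07F5, Situation 07F7, Lemmas 07FE,
  07FJ (with its proof, steps (1)–(26)), 07EU, Theorem 07GC and its proof; *Algebra*: Def. 030O,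
  Prop. 0322, Def. 0382, Lemma 0381, Lemma 07C3; *More on Algebra*: Def. 07BZ. [StacksProject]
* D. Popescu, *General Néron desingularization and approximation*, Nagoya Math. J. 104 (1986),
  Thm. (2.5) p. 89, Desingularization Thm. (2.3), Cor. (2.4). [Popescu1986]
* H. Matsumura, *Commutative Ring Theory*, §32 pp. 255–256 (geometrically regular, regular
  homomorphism). [Matsumura1987]
-/

noncomputable section

open TensorProduct

namespace Literature.AlgebraicGeometry.Resolution

universe u

/-! ## Separable (not necessarily algebraic) field extensions (Stacks 030O) -/

section Separable

/-- **Stacks, Algebra, Def. 030O (1)**: the field extension `K/k` is *separably generated* if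
there is a transcendence basis `s` of `K/k` such that `K/k(s)` is a separable algebraic
extension. [cite: StacksProject, Tag 030O] -/
def IsSeparablyGenerated (k K : Type*) [Field k] [Field K] [Algebra k K] : Prop :=
  ∃ s : Set K, IsTranscendenceBasis k ((↑) : s → K) ∧
    Algebra.IsSeparable (IntermediateField.adjoin k s) K

/-- **Stacks, Algebra, Def. 030O (2)**: the field extension `K/k` is *separable* if every
subextension `k ⊆ K' ⊆ K` with `K'` finitely generated over `k` is separably generated over
`k`. (For algebraic extensions this is the usual notion; in general it is weaker than
"separable algebraic", e.g. `k(x)/k` is separable.) [cite: StacksProject, Tag 030O] -/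
def IsSeparableFieldExtension (k K : Type*) [Field k] [Field K] [Algebra k K] : Prop :=
  ∀ K' : IntermediateField k K, K'.FG → IsSeparablyGenerated k K'

/-- A finitely generated extension of a perfect field is separably generated (Stacks, Algebra,
Lemma 030W for perfect ground fields; Mathlib's
`exists_isTranscendenceBasis_and_isSeparable_of_perfectField`). [cite: StacksProject, Tag 030W] -/
theorem isSeparablyGenerated_of_perfectField (k K : Type*) [Field k] [PerfectField k] [Field K]
    [Algebra k K] [Algebra.EssFiniteType k K] : IsSeparablyGenerated k K := by
  obtain ⟨s, hs, hsep⟩ := exists_isTranscendenceBasis_and_isSeparable_of_perfectField k K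
  exact ⟨(s : Set K), hs, hsep⟩

/-- **Stacks, Algebra, Prop. 0322 (1)** (characteristic zero part): every field extension of a
field of characteristic zero is separable. [cite: StacksProject, Tag 0322] -/
theorem isSeparableFieldExtension_of_charZero (k K : Type*) [Field k] [CharZero k] [Field K]
    [Algebra k K] : IsSeparableFieldExtension k K := by
  intro K' hK'
  haveI : Algebra.EssFiniteType k K' := IntermediateField.essFiniteType_iff.mpr hK'
  exact isSeparablyGenerated_of_perfectField k K'

/-- More generally, every extension of a perfect field is separable in the sense of 030O.
[folklore] -/
theorem isSeparableFieldExtension_of_perfectField (k K : Type*) [Field k] [PerfectField k]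
    [Field K] [Algebra k K] : IsSeparableFieldExtension k K := by
  intro K' hK'
  haveI : Algebra.EssFiniteType k K' := IntermediateField.essFiniteType_iff.mpr hK'
  exact isSeparablyGenerated_of_perfectField k K'

end Separable

/-! ## Two deep inputs of the proof of 07GC, as named facts -/

section Facts

/-- NAMED FACT — **Stacks, Lemma 07F5** ("Proving Popescu approximation reduces to algebras over
a field"): "If for every Situation 07F2 [a regular ring map `R → Λ` of Noetherian rings] where
`R` is a field PT holds, then PT holds in general", PT being "`Λ` is a filtered colimit of
smooth `R`-algebras", rendered in the factorisation form `HasSmoothFactorizations` (Algebra,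
Lemma 07C3). The printed proof uses More on Algebra 07C1, Proposition 07CM, Lemmas 07F3, 07F4,
the lifting lemma 07CP and the desingularization lemma 07CT. Users take
`(h : Stacks07F5_reduceToField)`. [cite: StacksProject, Tag 07F5] -/
def Stacks07F5_reduceToField : Prop :=
  (∀ (k Λ : Type u) [Field k] [CommRing Λ] [Algebra k Λ],
      IsNoetherianRing Λ → IsRegularHom k Λ → HasSmoothFactorizations k Λ) →
    ∀ (R Λ : Type u) [CommRing R] [CommRing Λ] [Algebra R Λ],
      IsNoetherianRing R → IsNoetherianRing Λ → IsRegularHom R Λ → HasSmoothFactorizations R Λ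

/-- NAMED FACT — **Stacks, Lemma 07FE** (separable residue field case): "Let
`k → A → Λ ⊃ 𝔮` be as in Situation 07F7 [`A` of finite presentation over `k`, `𝔮 ⊂ Λ` prime]
where (1) `k` is a field, (2) `Λ` is Noetherian, (3) `𝔮` is minimal over `𝔥_A`, (4) `Λ_𝔮` is a
regular local ring, and (5) the field extension `κ(𝔮)/k` is separable. Then `k → A → Λ ⊃ 𝔮`
can be resolved." Users take `(h : Stacks07FE_resolveSpecial)`.
[cite: StacksProject, Tag 07FE] -/
def Stacks07FE_resolveSpecial : Prop :=
  ∀ (k A Λ : Type u) [Field k] [CommRing A] [Algebra k A] [CommRing Λ] [Algebra k Λ],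
    Algebra.FinitePresentation k A → IsNoetherianRing Λ →
      ∀ (φ : A →ₐ[k] Λ) (q : Ideal Λ) [q.IsPrime], q ∈ (hIdeal k φ).minimalPrimes →
        IsRegularLocalRing (Localization.AtPrime q) →
          IsSeparableFieldExtension k q.ResidueField → CanResolve k φ q

end Facts

/-! ## The local problem of 07F7 at the minimal primes of `𝔥_A` -/

section LocalProblem

/-- **"It now suffices to resolve `R → A → Λ ⊃ 𝔮`"** (Stacks, proof of 07GC): the property of
`R → Λ` that `R → A → Λ ⊃ 𝔮` can be resolved (`CanResolve`, Stacks, text after Situation 07F7)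
for EVERY `A` of finite presentation over `R`, every `φ : A → Λ` and every prime `𝔮 ⊂ Λ`
minimal over `𝔥_A` — the common shape of the conclusions of Lemmas 07FE and 07FJ, quantified as
the Noetherian induction of 07GC consumes them. A predicate on `R → Λ`, not a named fact.
[cite: StacksProject, Tag 07GC (proof)] -/
def CanResolveAtMinimalPrimes (R Λ : Type u) [CommRing R] [CommRing Λ] [Algebra R Λ] : Prop :=
  ∀ (A : Type u) [CommRing A] [Algebra R A], Algebra.FinitePresentation R A →
    ∀ (φ : A →ₐ[R] Λ) (q : Ideal Λ) [q.IsPrime], q ∈ (hIdeal R φ).minimalPrimes → CanResolve R φ q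

end LocalProblem

/-! ## Bridges: regular homomorphisms out of a field, geometric regularity, regular rings -/

section Bridges

variable {k Λ : Type u} [Field k] [CommRing Λ] [Algebra k Λ]

/-- A `k`-algebra geometrically regular over the field `k` is a regular ring (take `k' = k`:
`k ⊗_k Λ ≅ Λ`). [folklore] -/
theorem IsGeometricallyRegular.isRegularRing (h : IsGeometricallyRegular k Λ) : IsRegularRing Λ :=
  haveI : IsRegularRing (k ⊗[k] Λ) := h k inferInstance
  IsRegularRing.of_ringEquiv (Algebra.TensorProduct.lid k Λ).toRingEquiv

/-- In particular its local rings are regular local rings (hypothesis (4) of Stacks 07FE in the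
characteristic-zero branch of the proof of 07GC). [folklore] -/
theorem IsGeometricallyRegular.isRegularLocalRing_localization (h : IsGeometricallyRegular k Λ)
    (q : Ideal Λ) [q.IsPrime] : IsRegularLocalRing (Localization.AtPrime q) :=
  haveI := h.isRegularRing
  IsRegularRing.isRegularLocalRing_localization q

/-- A regular homomorphism `k → Λ` out of a field has `Λ` geometrically regular over `k`: its
only fibre is `κ(0) ⊗_k Λ` with `κ(0) = k`, and `k' ⊗_{κ(0)} (κ(0) ⊗_k Λ) ≅ k' ⊗_k Λ` for every
finite `k'/k` ("Situation 07F2 where `R` is a field" is "`Λ` Noetherian and geometrically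
regular over `k`", as used in the proof of 07GC). [folklore] -/
theorem IsRegularHom.isGeometricallyRegular_of_field (h : IsRegularHom k Λ) :
    IsGeometricallyRegular k Λ := by
  intro k' _ _ hfin
  have hκ : IsGeometricallyRegular (⊥ : Ideal k).ResidueField ((⊥ : Ideal k).ResidueField ⊗[k] Λ) :=
    h.2 ⊥
  set κ := (⊥ : Ideal k).ResidueField
  let e₀ : k ≃ₐ[k] κ := Ideal.algEquivResidueFieldOfField ⊥
  letI : Algebra κ k' := ((algebraMap k k').comp (e₀.symm : κ ≃ₐ[k] k).toAlgHom.toRingHom).toAlgebra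
  haveI : IsScalarTower k κ k' := IsScalarTower.of_algebraMap_eq fun x => by
    change algebraMap k k' x = algebraMap k k' ((e₀.symm : κ ≃ₐ[k] k) (algebraMap k κ x))
    rw [← Ideal.algEquivResidueFieldOfField_apply, AlgEquiv.symm_apply_apply]
  haveI : Module.Finite κ k' := Module.Finite.of_restrictScalars_finite k κ k'
  haveI : IsRegularRing (k' ⊗[κ] (κ ⊗[k] Λ)) := hκ k' inferInstance
  exact IsRegularRing.of_ringEquiv
    (Algebra.TensorProduct.cancelBaseChange k κ k' k' Λ).toRingEquiv

end Bridges

/-! ## The field case of 07GC: Noetherian induction on `𝔥_A` -/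

section FieldCase

/-- **The Noetherian induction of Stacks 07GC**, PROVED from 07EU
(`factorsThroughSmooth_of_hIdeal_eq_top`): over a Noetherian ring `R`, if `R → A → Λ ⊃ 𝔮` can
be resolved for every `A` of finite presentation and every `𝔮` minimal over `𝔥_A`, then PT
holds for `R → Λ` (`Λ` Noetherian). Induction step: for `𝔥_A ≠ Λ` pick `𝔮` minimal over `𝔥_A`,
resolve to get `A → B → Λ` with `𝔥_A ⊊ 𝔥_B`, and apply the induction hypothesis to `B → Λ`.
(Printed for `R = k` a field; the argument is verbatim the same.)
[cite: StacksProject, Tag 07GC (proof)] -/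
theorem hasSmoothFactorizations_of_canResolveAtMinimalPrimes {R Λ : Type u} [CommRing R]
    [CommRing Λ] [Algebra R Λ] [IsNoetherianRing R] [IsNoetherianRing Λ]
    (hres : CanResolveAtMinimalPrimes R Λ) : HasSmoothFactorizations R Λ := by
  suffices key : ∀ (I : Ideal Λ) (A : Type u) [CommRing A] [Algebra R A],
      Algebra.FiniteType R A → ∀ φ : A →ₐ[R] Λ, hIdeal R φ = I → FactorsThroughSmooth R φ by
    intro A _ _ hA φ
    exact key _ A hA φ rfl
  intro I
  induction I using IsNoetherian.induction with
  | hgt I ih =>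
    intro A _ _ hA φ hI
    haveI : Algebra.FinitePresentation R A := (Algebra.FinitePresentation.of_finiteType).mp hA
    by_cases htop : I = ⊤
    · exact factorsThroughSmooth_of_hIdeal_eq_top φ (hI.trans htop)
    · -- a minimal prime `𝔮` of `𝔥_A`
      obtain ⟨M, hM, hIM⟩ := Ideal.exists_le_maximal I htop
      haveI := hM.isPrime
      obtain ⟨q, hq, -⟩ := Ideal.exists_minimalPrimes_le hIM
      haveI hqp : q.IsPrime := hq.1.1
      have hqmin : q ∈ (hIdeal R φ).minimalPrimes := by rw [hI]; exact hq
      -- resolve `R → A → Λ ⊃ 𝔮`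
      obtain ⟨B, _, _, hB, v, w, hwv, hle, hnot⟩ := hres A inferInstance φ q hqmin
      -- `𝔥_A ⊊ 𝔥_B`, so the induction hypothesis applies to `B → Λ`
      have hlt : I < hIdeal R w := by
        refine lt_of_le_of_ne (hI ▸ hle) fun heq => hnot ?_
        rw [← heq, ← hI]
        exact hqmin.1.2
      haveI := hB
      exact FactorsThroughSmooth.of_comp v (ih _ hlt B inferInstance w rfl) hwv

/-- **The characteristic-zero branch of the proof of 07GC**, PROVED from the fact 07FE: over a
field `k` of characteristic zero with `Λ` Noetherian and geometrically regular over `k`, every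
`k → A → Λ ⊃ 𝔮` with `𝔮` minimal over `𝔥_A` can be resolved — hypotheses (4) (`Λ_𝔮` regular)
and (5) (`κ(𝔮)/k` separable) of 07FE hold by geometric regularity and characteristic zero.
[cite: StacksProject, Tag 07GC (proof)] -/
theorem canResolveAtMinimalPrimes_of_charZero (hFE : Stacks07FE_resolveSpecial.{u})
    (k Λ : Type u) [Field k] [CharZero k] [CommRing Λ] [Algebra k Λ] [IsNoetherianRing Λ]
    (hΛ : IsGeometricallyRegular k Λ) : CanResolveAtMinimalPrimes k Λ :=
  fun A _ _ hA φ q _ hqmin =>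
    hFE k A Λ hA inferInstance φ q hqmin (hΛ.isRegularLocalRing_localization q)
      (isSeparableFieldExtension_of_charZero k _)

/-- Hence, in characteristic zero, PT for `k → Λ` (`Λ` Noetherian and geometrically regular
over `k`) follows from the fact 07FE alone. [cite: StacksProject, Tag 07GC (proof)] -/
theorem hasSmoothFactorizations_of_charZero (hFE : Stacks07FE_resolveSpecial.{u})
    (k Λ : Type u) [Field k] [CharZero k] [CommRing Λ] [Algebra k Λ] [IsNoetherianRing Λ]
    (hΛ : IsGeometricallyRegular k Λ) : HasSmoothFactorizations k Λ :=
  hasSmoothFactorizations_of_canResolveAtMinimalPrimes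
    (canResolveAtMinimalPrimes_of_charZero hFE k Λ hΛ)

/-- **The field case of Stacks 07GC** in every characteristic: for a field `k` and a Noetherian
`Λ` geometrically regular over `k`, PT holds for `k → Λ`, from 07FE if `char k = 0` and from
Lemma 07FJ — the hypothesis `hFJ`, its conclusion for this `k → Λ` in characteristic `p > 0` —
otherwise. [cite: StacksProject, Tag 07GC (proof)] -/
theorem hasSmoothFactorizations_of_isGeometricallyRegular (hFE : Stacks07FE_resolveSpecial.{u})
    (k Λ : Type u) [Field k] [CommRing Λ] [Algebra k Λ] [IsNoetherianRing Λ]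
    (hΛ : IsGeometricallyRegular k Λ)
    (hFJ : ∀ (p : ℕ) [Fact p.Prime] [CharP k p], CanResolveAtMinimalPrimes k Λ) :
    HasSmoothFactorizations k Λ := by
  rcases CharP.exists' k with hchar | ⟨p, hp, hpk⟩
  · haveI := hchar
    exact hasSmoothFactorizations_of_charZero hFE k Λ hΛ
  · haveI := hp
    haveI := hpk
    exact hasSmoothFactorizations_of_canResolveAtMinimalPrimes (hFJ p)

/-- The field case with the hypothesis in the form of Situation 07F2 ("`k → Λ` regular, `k` a
field, `Λ` Noetherian"), via `IsRegularHom.isGeometricallyRegular_of_field`; again with the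
conclusion of Lemma 07FJ for this `k → Λ` (in characteristic `p > 0`) as the hypothesis `hFJ`.
[cite: StacksProject, Tag 07GC (proof)] -/
theorem hasSmoothFactorizations_field (hFE : Stacks07FE_resolveSpecial.{u}) (k Λ : Type u)
    [Field k] [CommRing Λ] [Algebra k Λ] (hΛ : IsNoetherianRing Λ) (hreg : IsRegularHom k Λ)
    (hFJ : ∀ (p : ℕ) [Fact p.Prime] [CharP k p], CanResolveAtMinimalPrimes k Λ) :
    HasSmoothFactorizations k Λ :=
  haveI := hΛ
  hasSmoothFactorizations_of_isGeometricallyRegular hFE k Λ hreg.isGeometricallyRegular_of_field hFJ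

end FieldCase

/-! ## Assembly -/

section Assembly

/-- The target fact, unfolded: `Popescu1986_generalNeronDesingularization` says precisely that
PT (in factorisation form) holds for every regular homomorphism of Noetherian rings, i.e. it is
Stacks 07GC read through Algebra, Lemma 07C3. [cite: StacksProject, Tag 07GC] -/
theorem popescu1986_iff_hasSmoothFactorizations :
    Popescu1986_generalNeronDesingularization.{u} ↔
      ∀ (R Λ : Type u) [CommRing R] [CommRing Λ] [Algebra R Λ],
        IsNoetherianRing R → IsNoetherianRing Λ → IsRegularHom R Λ →
          HasSmoothFactorizations R Λ :=
  Iff.rfl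

/-- **ASSEMBLY of Popescu's theorem along the proof of Stacks 07GC**: General Néron
desingularisation (`Popescu1986_generalNeronDesingularization` = Popescu 1986, Thm. (2.5)
(i) ⇒ (ii)) follows from the named facts `Stacks07F5_reduceToField` (Lemma 07F5) and
`Stacks07FE_resolveSpecial` (Lemma 07FE) together with **Lemma 07FJ**, which is the hypothesis
`hFJ` stated as printed: "Let `k → A → Λ ⊃ 𝔮` be as in Situation 07F7 where (1) `k` is a field
of characteristic `p > 0`, (2) `Λ` is Noetherian and geometrically regular over `k`, (3) `𝔮` is
minimal over `𝔥_A`. Then `k → A → Λ ⊃ 𝔮` can be resolved." The rest of the printed proof —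
Lemma 07EU, the Noetherian induction on `𝔥_A`, the case distinction on the characteristic with
(4), (5) of 07FE supplied by geometric regularity and characteristic zero — is proved in this
file and in `NeronPopescuSingularIdeal.lean`; 07FJ is part of what a discharge of the target
must prove. [cite: StacksProject, Tag 07GC] -/
theorem Popescu1986_generalNeronDesingularization_of_stacks (h5 : Stacks07F5_reduceToField.{u})
    (hFE : Stacks07FE_resolveSpecial.{u})
    (hFJ : ∀ (p : ℕ) [Fact p.Prime] (k Λ : Type u) [Field k] [CharP k p] [CommRing Λ]
      [Algebra k Λ], IsNoetherianRing Λ → IsGeometricallyRegular k Λ →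
        CanResolveAtMinimalPrimes k Λ) :
    Popescu1986_generalNeronDesingularization.{u} := by
  intro A A' _ _ _ hA hA' hreg B _ _ hB f
  exact h5 (fun k Λ _ _ _ hΛ hkΛ => hasSmoothFactorizations_field hFE k Λ hΛ hkΛ
    fun p _ _ => hFJ p k Λ hΛ hkΛ.isGeometricallyRegular_of_field) A A' hA hA' hreg B hB f

end Assembly

end Literature.AlgebraicGeometry.Resolution

end
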